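import Summits.HodgeConjecture.HodgeConjecture.Theses.SiuRepresentability
import HarnessLib

/-!
# Route SiuRepresentability — `KaehlerRepresentable` (item stmt-HodgeConjecture-9029): the typed split along the decomposable / indecomposable seam of the Hodge ring

The deciding crux `KaehlerRepresentable` of route `SiuRepresentability` (for a smooth projective compact
ball quotient `X` of dimension `n` and `2 ≤ p ≤ n/2`, `k = n - p`: every rational Hodge `(p,p)`-class
lies in the `ℂ`-span of the KÄHLER-REPRESENTABLE classes `c'`, `c' ⌢ [X(ℂ)] = f_*[M(ℂ)]` for a smooth
projective `k`-fold `M` and a continuous `f : M(ℂ) → X(ℂ)`) is concluded BY NAME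
(`kaehlerRepresentable_of_subs`) from two statements spelled out verbatim as hypotheses — the two children of the
crux-strategist's split (seat `planner-cstrat-stmt-HodgeConjecture-9029-r1-0`, 2026-08-17; shape
`C₁ → C₂ → C` for `ledger route edit --split KaehlerRepresentable`):

* `h₁` — **`IndecomposableRepresentable`** (the indecomposable sector): every rational Hodge
  `(p,p)`-class on a compact ball quotient, `2 ≤ p ≤ n/2`, lies in the span of the
  Kähler-representable classes TOGETHER WITH the decomposable Hodge classes `a ∪ b`,
  `a ∈ Hdg^{i,i}_ℚ(X)`, `b ∈ Hdg^{j,j}_ℚ(X)`, `i + j = p`, `i, j ≥ 1` — Kähler–Steenrod representability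
  is asked only of a complement of the decomposable part `Σ_{i+j=p} Hdg^i · Hdg^j` of the Hodge ring
  (for arithmetic `Γ` and `3p < n` such a complement is spanned by special cycles, Bergeron–Millson–Moeglin
  Thm. 4, conditional; the first open instances are the indecomposable `(2,2)`-classes of compact ball
  4- and 5-folds);
* `h₂` — **`RepresentableCupHodge`** (the decomposable sector, hereditary form): on a compact ball
  quotient the cup product of a codimension-`i` class which is ALGEBRAIC OR KÄHLER-REPRESENTABLE
  (`i ≥ 1`) with a RATIONAL HODGE `(j,j)`-class (`j ≥ 1`, `i + j = p ≤ n/2`) lies in the span of the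
  Kähler-representable classes of codimension `p`. By Siu rigidity the first factor is a combination of
  cycle classes `cl(Z)`, and `cl(Z) ∪ b = g_!(g^* b)` for a resolution `g : Z̃ → Z ⊂ X` (projection
  formula), so `h₂` is Kähler–Steenrod SUPPLY FOR THE RESTRICTIONS `g^* b` of Hodge classes to the proper
  subvarieties `Z̃` of `X` — which are not ball quotients (no rigidity there): a statement about different
  objects than `h₁`, open (it contains `L ∪ Hdg^{j,j}_ℚ ⊆ span Rep` for an ample class `L`, `j` in the
  middle third) and, like `h₁`, implied by the Hodge conjecture.

The assembly is a strong induction on the codimension `p` in which the two sectors interact: a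
decomposable generator `a ∪ b` of codimension `p` has its first factor of codimension `i < p`; if
`i = 1` it is a divisor class by Lefschetz's theorem on `(1,1)`-classes — the route's PROVED item
`LefschetzOneOne_holds` — and if `i ≥ 2` it lies in the span of the Kähler-representable classes of
codimension `i` by the INDUCTION HYPOTHESIS (i.e. by `h₁` and `h₂` at the lower codimension, again
`≤ n/2`); linearity of `∪` in the first factor (`Submodule.map₂_span_span`) then puts `a ∪ b` in the
span of the products (algebraic-or-representable) `∪` (rational Hodge), which `h₂` sends into the
representable span. No `def`s; unconditional; standard axioms; no named facts (only the landed
`lefschetzOneOne_proof`, through `LefschetzOneOne_holds`).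
-/

noncomputable section

set_option linter.dupNamespace false

open scoped Manifold ContinuousMap

namespace Summit.HodgeConjecture.HodgeConjecture.Cruxes.KaehlerRepresentable

open Summit.HodgeConjecture.HodgeConjecture.Theses.SiuRepresentability

/-- **Glue of the split of `KaehlerRepresentable` along the decomposable / indecomposable seam.**
If (h₁) every rational Hodge `(p,p)`-class on a compact ball quotient (`2 ≤ p ≤ n/2`) lies in the
span of the Kähler-representable classes and the decomposable Hodge classes `a ∪ b`
(`a ∈ Hdg^{i,i}_ℚ`, `b ∈ Hdg^{j,j}_ℚ`, `i + j = p`, `i, j ≥ 1`), and (h₂) the cup product of an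
algebraic-or-Kähler-representable class of codimension `i ≥ 1` with a rational Hodge `(j,j)`-class,
`j ≥ 1`, `i + j = p ≤ n/2`, lies in the span of the Kähler-representable classes of codimension `p`,
then `KaehlerRepresentable`. Proof: strong induction on `p`; Lefschetz `(1,1)` (`LefschetzOneOne_holds`)
for a first factor of codimension `1`, the induction hypothesis for a first factor of codimension
`≥ 2`, linearity of the cup product in that factor. Shape `C₁ → C₂ → C` of a route split glue.
[cite: VoisinHodgeI2002, §11.3 and Thm. 11.30] [cite: VoisinHodgeII2003, §9.2.4 Prop. 9.20]
[cite: Siu1980, Thm. 1] -/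
theorem kaehlerRepresentable_of_subs :
    (∀ ⦃n : ℕ⦄ ⦃X : Literature.AlgebraicGeometry.Motives.SchemeOver ℂ⦄ (hX : Literature.AlgebraicGeometry.Motives.IsSmoothProjective n X), (∃ (A : Literature.AlgebraicGeometry.HodgeTheory.HodgeModel n X) (π : EuclideanSpace ℂ (Fin n) → A.carrier), (∀ z ∈ Metric.ball (0 : EuclideanSpace ℂ (Fin n)) 1, MDifferentiableAt 𝓘(ℂ, EuclideanSpace ℂ (Fin n)) 𝓘(ℂ, A.model) π z) ∧ IsCoveringMap ((Metric.ball (0 : EuclideanSpace ℂ (Fin n)) 1).restrict π)) → ∀ (p k : ℕ) (hpk : p + k = n), 2 ≤ p → 2 * p ≤ n → ∀ c : Literature.AlgebraicGeometry.HodgeTheory.complexBetti X (2 * p), Literature.AlgebraicGeometry.HodgeTheory.IsRationalClass c → Literature.AlgebraicGeometry.HodgeTheory.IsOfHodgeType n X (2 * p) p p c → c ∈ Submodule.span ℂ ({c' : Literature.AlgebraicGeometry.HodgeTheory.complexBetti X (2 * p) | ∃ (μX : Literature.AlgebraicTopology.SingularHomology.HomologicalOrientation ℂ (Literature.AlgebraicGeometry.Motives.ComplexPoints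 X) (2 * n)) (M : Literature.AlgebraicGeometry.Motives.SchemeOver ℂ) (_ : Literature.AlgebraicGeometry.Motives.IsSmoothProjective k M) (μM : Literature.AlgebraicTopology.SingularHomology.HomologicalOrientation ℂ (Literature.AlgebraicGeometry.Motives.ComplexPoints M) (2 * k)) (f : C(Literature.AlgebraicGeometry.Motives.ComplexPoints M, Literature.AlgebraicGeometry.Motives.ComplexPoints X)), Literature.AlgebraicTopology.SingularHomology.capProduct (show 2 * p + 2 * k = 2 * n by omega) c' μX.fundamentalClass = Literature.AlgebraicTopology.SingularHomology.singularHomology.map ℂ ℂ f (2 * k) μM.fundamentalClass} ∪ {d : Literature.AlgebraicGeometry.HodgeTheory.complexBetti X (2 * p) | ∃ (i j : ℕ) (hij : i + j = p) (_ : 1 ≤ i) (_ : 1 ≤ j) (a : Literature.AlgebraicGeometry.HodgeTheory.complexBetti X (2 * i)) (b : Literature.AlgebraicGeometry.HodgeTheory.complexBetti X (2 * j)), Literature.AlgebraicGeometry.HodgeTheory.IsRationalClass a ∧ Literature.AlgebraicGeometry.HodgeTheory.IsOfHodgeType n X (2 * i) i i a ∧ Literature.AlgebraicGeometry.HodgeTheory.IsRationalClass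 b ∧ Literature.AlgebraicGeometry.HodgeTheory.IsOfHodgeType n X (2 * j) j j b ∧ d = Literature.AlgebraicTopology.SingularHomology.cupProduct (show 2 * i + 2 * j = 2 * p by omega) a b})) →
    (∀ ⦃n : ℕ⦄ ⦃X : Literature.AlgebraicGeometry.Motives.SchemeOver ℂ⦄ (hX : Literature.AlgebraicGeometry.Motives.IsSmoothProjective n X), (∃ (A : Literature.AlgebraicGeometry.HodgeTheory.HodgeModel n X) (π : EuclideanSpace ℂ (Fin n) → A.carrier), (∀ z ∈ Metric.ball (0 : EuclideanSpace ℂ (Fin n)) 1, MDifferentiableAt 𝓘(ℂ, EuclideanSpace ℂ (Fin n)) 𝓘(ℂ, A.model) π z) ∧ IsCoveringMap ((Metric.ball (0 : EuclideanSpace ℂ (Fin n)) 1).restrict π)) → ∀ (i j p ki k : ℕ) (hij : i + j = p) (hik : i + ki = n) (hpk : p + k = n), 1 ≤ i → 1 ≤ j → 2 * p ≤ n → ∀ a : Literature.AlgebraicGeometry.HodgeTheory.complexBetti X (2 * i), (a ∈ Literature.AlgebraicGeometry.HodgeTheory.algebraicClasses X i ∨ ∃ (μX : Literature.AlgebraicTopology.SingularHomology.HomologicalOrientation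 ℂ (Literature.AlgebraicGeometry.Motives.ComplexPoints X) (2 * n)) (M : Literature.AlgebraicGeometry.Motives.SchemeOver ℂ) (_ : Literature.AlgebraicGeometry.Motives.IsSmoothProjective ki M) (μM : Literature.AlgebraicTopology.SingularHomology.HomologicalOrientation ℂ (Literature.AlgebraicGeometry.Motives.ComplexPoints M) (2 * ki)) (f : C(Literature.AlgebraicGeometry.Motives.ComplexPoints M, Literature.AlgebraicGeometry.Motives.ComplexPoints X)), Literature.AlgebraicTopology.SingularHomology.capProduct (show 2 * i + 2 * ki = 2 * n by omega) a μX.fundamentalClass = Literature.AlgebraicTopology.SingularHomology.singularHomology.map ℂ ℂ f (2 * ki) μM.fundamentalClass) → ∀ b : Literature.AlgebraicGeometry.HodgeTheory.complexBetti X (2 * j), Literature.AlgebraicGeometry.HodgeTheory.IsRationalClass b → Literature.AlgebraicGeometry.HodgeTheory.IsOfHodgeType n X (2 * j) j j b → Literature.AlgebraicTopology.SingularHomology.cupProduct (show 2 * i + 2 * j = 2 * p by omega) a b ∈ Submodule.span ℂ {c' : Literature.AlgebraicGeometry.HodgeTheory.complexBetti X (2 * p) | ∃ (μX : Literature.AlgebraicTopology.SingularHomology.HomologicalOrientation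 ℂ (Literature.AlgebraicGeometry.Motives.ComplexPoints X) (2 * n)) (M : Literature.AlgebraicGeometry.Motives.SchemeOver ℂ) (_ : Literature.AlgebraicGeometry.Motives.IsSmoothProjective k M) (μM : Literature.AlgebraicTopology.SingularHomology.HomologicalOrientation ℂ (Literature.AlgebraicGeometry.Motives.ComplexPoints M) (2 * k)) (f : C(Literature.AlgebraicGeometry.Motives.ComplexPoints M, Literature.AlgebraicGeometry.Motives.ComplexPoints X)), Literature.AlgebraicTopology.SingularHomology.capProduct (show 2 * p + 2 * k = 2 * n by omega) c' μX.fundamentalClass = Literature.AlgebraicTopology.SingularHomology.singularHomology.map ℂ ℂ f (2 * k) μM.fundamentalClass}) →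
    KaehlerRepresentable := by
  intro h1 h2 n X hX hB p
  induction p using Nat.strong_induction_on with
  | _ p ih =>
  intro k hpk hp h2p c hc hh
  refine (Submodule.span_le.mpr ?_) (h1 hX hB p k hpk hp h2p c hc hh)
  rintro d (hd | hd)
  · exact Submodule.subset_span hd
  · obtain ⟨i, j, hij, hi, hj, a, b, ha, hha, hb, hhb, rfl⟩ := hd
    -- each factor lies in the span of the (algebraic ∪ Kähler-representable) classes of its codimension:
    -- codimension 1 by Lefschetz (1,1), codimension ≥ 2 by the induction hypothesis
    have hfac : ∀ (i ki : ℕ) (hik : i + ki = n), 1 ≤ i → i < p →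
        ∀ a : Literature.AlgebraicGeometry.HodgeTheory.complexBetti X (2 * i),
          Literature.AlgebraicGeometry.HodgeTheory.IsRationalClass a →
          Literature.AlgebraicGeometry.HodgeTheory.IsOfHodgeType n X (2 * i) i i a →
          a ∈ Submodule.span ℂ {a' : Literature.AlgebraicGeometry.HodgeTheory.complexBetti X (2 * i) |
            a' ∈ Literature.AlgebraicGeometry.HodgeTheory.algebraicClasses X i ∨
            ∃ (μX : Literature.AlgebraicTopology.SingularHomology.HomologicalOrientation ℂ (Literature.AlgebraicGeometry.Motives.ComplexPoints X) (2 * n)) (M : Literature.AlgebraicGeometry.Motives.SchemeOver ℂ) (_ : Literature.AlgebraicGeometry.Motives.IsSmoothProjective ki M) (μM : Literature.AlgebraicTopology.SingularHomology.HomologicalOrientation ℂ (Literature.AlgebraicGeometry.Motives.ComplexPoints M) (2 * ki)) (f : C(Literature.AlgebraicGeometry.Motives.ComplexPoints M, Literature.AlgebraicGeometry.Motives.ComplexPoints X)), Literature.AlgebraicTopology.SingularHomology.capProduct (show 2 * i + 2 * ki = 2 * n by omega) a' μX.fundamentalClass = Literature.AlgebraicTopology.SingularHomology.singularHomology.map ℂ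 ℂ f (2 * ki) μM.fundamentalClass} := by
      intro i ki hik hi hip a ha hha
      rcases Nat.lt_or_ge i 2 with hi2 | hi2
      · obtain rfl : i = 1 := by omega
        exact Submodule.subset_span (Or.inl (LefschetzOneOne_holds hX a ha hha))
      · exact Submodule.span_mono (fun x hx ↦ Or.inr hx) (ih i hip ki hik hi2 (by omega) a ha hha)
    have haS := hfac i (n - i) (by omega) hi (by omega) a ha hha
    have hbS : b ∈ Submodule.span ℂ {b' : Literature.AlgebraicGeometry.HodgeTheory.complexBetti X (2 * j) |
        Literature.AlgebraicGeometry.HodgeTheory.IsRationalClass b' ∧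
          Literature.AlgebraicGeometry.HodgeTheory.IsOfHodgeType n X (2 * j) j j b'} :=
      Submodule.subset_span ⟨hb, hhb⟩
    -- bilinearity of `∪`: the product lies in the span of the products of generators
    have hmem := Submodule.apply_mem_map₂
      (Literature.AlgebraicTopology.SingularHomology.cupProduct (show 2 * i + 2 * j = 2 * p by omega)) haS hbS
    rw [Submodule.map₂_span_span] at hmem
    refine (Submodule.span_le.mpr ?_) hmem
    rintro _ ⟨x, hx, y, ⟨hy, hhy⟩, rfl⟩
    exact h2 hX hB i j p (n - i) k hij (by omega) hpk hi hj h2p x hx y hy hhy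

end Summit.HodgeConjecture.HodgeConjecture.Cruxes.KaehlerRepresentable

end
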